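import Literature.NumberTheory.Automorphic.AshSmithTheoryHeckeAttachedProofs
import Mathlib.NumberTheory.NumberField.Cyclotomic.Ideal
import Mathlib.NumberTheory.Padics.HeightOneSpectrum
import Mathlib.FieldTheory.KummerExtension
import HarnessLib

/-!
# Ash (2003), *Smith theory and Hecke operators* — proofs towards the named fact
# `Ash2003_inducedRayClassCharacter_attached`: the trivial character, Galois side
# (`det(X - Ind(𝟙)(Frob_l)) = ∏_{j < p-1} (X - l^j)`)

Topic `NumberTheory/Automorphic`; companion of `Literature.NumberTheory.Automorphic.AshSmithTheoryHecke`
(the named fact `Ash2003_inducedRayClassCharacter_attached` = A. Ash, *Smith theory and Hecke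
operators*, J. Algebra **259** (2003) 43–58 [Ash2003], Thm. 1.1 / Cor. 4.4).  For the TRIVIAL ray
class character `θ = 𝟙` of `L = ℚ(ζ_p)`, [Ash2003]'s representation `ρ_𝟙 = Ind_{G_L}^{G_ℚ} 𝟙` is the
regular representation of `Gal(L/ℚ) ≅ (ℤ/p)^×`, i.e. `𝟙 ⊕ ω ⊕ ⋯ ⊕ ω^{p-2}` (`ω` the mod `p` cyclotomic
character), whose Frobenius characteristic polynomial at `l ∤ pN` is `∏_{j<p-1} (X - l^j)` in
characteristic `p` — the Hecke–Frobenius polynomial of the degree-`0` eigenclass `[1]`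
(`AshSmithTheoryHeckeDegreeZeroProofs`) once the double-coset counts are evaluated as Gaussian
binomials.  This file proves that Galois-side identity in the tree's typing:

* `Ash2003.hasFrobCharpolyAt_induce_of_isGaloisAvatar_one`: for a Galois avatar `ϑ` of the
  trivial character modulo `(pN)` and `q_v = l ∤ p · (pN)`,
  `det(X - Ind(ϑ)(Frob_v)) = ∏_{j < p-1} (X - l^j)` (`FramedGaloisRep.HasFrobCharpolyAt`),
from `Ash2003.hasFrobCharpolyAt_induce_of_isGaloisAvatar` (`det = ∏_{w ∣ l} (X^{f(w|l)} - 1)`) and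
the **splitting of `l` in `ℚ(ζ_p)`** in the tree's language of places (`HeightOneSpectrum`):

* `Ash2003.residueCard_prime`: the residue characteristic `q_v` of a finite place `v` of `ℚ` is a
  prime number (Mathlib `Rat.HeightOneSpectrum.natGenerator`);
* `Ash2003.inertiaDeg_eq_orderOf`: every place `w ∣ v` of `ℚ(ζ_p)` (`q_v ≠ p`) has residue degree
  `f(w|v) =` the order of `q_v` in `(ℤ/p)^×` (Mathlib
  `IsCyclotomicExtension.Rat.inertiaDeg_eq_of_not_dvd`, transported from the base `ℤ` to `𝓞 ℚ` by
  the tower law `Ideal.inertiaDeg_tower` and `f(v|q_v) = 1`);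
* `Ash2003.card_placesOver_mul_orderOf`: `#{w ∣ v} · f = p - 1` (the fundamental identity, Mathlib
  `Ideal.ncard_primesOver_mul_ramificationIdxIn_mul_inertiaDegIn`, with `e = 1`,
  `IsCyclotomicExtension.Rat.ramificationIdx_eq_of_not_dvd`);
* `Ash2003.prod_range_X_sub_C_pow_eq`: `∏_{j<p-1} (X - l^j) = (X^f - 1)^{(p-1)/f}` over any
  `ℤ/p`-algebra (`l` has order `f` in `(ℤ/p)^×`, so `X^f - 1 = ∏_{i<f} (X - l^i)`, Mathlib
  `X_pow_sub_C_eq_prod`).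

## References

* A. Ash, *Smith theory and Hecke operators*, J. Algebra 259 (2003) 43–58, Thm. 1.1, Lemma 4.2
  [Ash2003].
* J. Neukirch, *Algebraic Number Theory* (1999), Ch. I (10.4) (decomposition of primes in
  cyclotomic fields), Ch. I §8 (fundamental identity) [NeukirchANT1999].
-/

noncomputable section

open scoped NumberField
open IsDedekindDomain Polynomial

namespace Literature.NumberTheory.Automorphic

namespace Ash2003

open GaloisRepresentations

/-! ### Places of `ℚ`: the residue characteristic is prime -/

/-- **The residue characteristic `q_v` of a finite place `v` of `ℚ` is a prime number** (`𝓞 ℚ ≅ ℤ`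
and `v = (q_v)`; Mathlib `Rat.HeightOneSpectrum.natGenerator`, `prime_natGenerator`: `q_v` and the
positive generator of `v ∩ ℤ` divide each other). [folklore] -/
theorem residueCard_prime (v : HeightOneSpectrum (𝓞 ℚ)) : v.residueCard.Prime := by
  have h1 : Rat.HeightOneSpectrum.natGenerator v ∣ v.residueCard := by
    rw [Rat.HeightOneSpectrum.natGenerator_dvd_iff]
    have := Ideal.mem_map_of_mem (Rat.IsIntegralClosure.intEquiv (𝓞 ℚ))
      (Ideal.absNorm_mem v.asIdeal)
    rwa [map_natCast] at this
  have h2 : v.residueCard ∣ Rat.HeightOneSpectrum.natGenerator v := by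
    refine residueCard_dvd_of_natCast_mem ?_
    have h3 : ((Rat.HeightOneSpectrum.natGenerator v : ℕ) : ℤ) ∈
        Ideal.map (Rat.IsIntegralClosure.intEquiv (𝓞 ℚ)) v.asIdeal :=
      (Rat.HeightOneSpectrum.natGenerator_dvd_iff v).mp dvd_rfl
    rwa [← map_natCast (Rat.IsIntegralClosure.intEquiv (𝓞 ℚ)), Ideal.apply_mem_of_equiv_iff] at h3
  rw [Nat.dvd_antisymm h2 h1]
  exact Rat.HeightOneSpectrum.prime_natGenerator v

/-- A proper ideal `P` of a ring containing the prime number `ℓ` lies over `(ℓ) ⊆ ℤ`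
(`(ℓ)` is maximal in `ℤ`). [folklore] -/
theorem under_int_eq_span_of_natCast_mem {S : Type*} [CommRing S] {P : Ideal S} (hP : P ≠ ⊤)
    {ℓ : ℕ} (hℓ : ℓ.Prime) (hmem : (ℓ : S) ∈ P) : P.under ℤ = Ideal.span {(ℓ : ℤ)} := by
  have hle : Ideal.span {(ℓ : ℤ)} ≤ P.under ℤ := by
    rw [Ideal.span_le, Set.singleton_subset_iff, SetLike.mem_coe]
    exact Ideal.mem_comap.mpr (by rw [map_natCast]; exact hmem)
  have hprime : (Ideal.span {(ℓ : ℤ)}).IsPrime :=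
    (Ideal.span_singleton_prime (by exact_mod_cast hℓ.ne_zero)).mpr (Nat.prime_iff_prime_int.mp hℓ)
  have hmax : (Ideal.span {(ℓ : ℤ)}).IsMaximal := hprime.isMaximal (by simp [hℓ.ne_zero])
  exact (hmax.eq_of_le (Ideal.comap_ne_top _ hP) hle).symm

/-- `v` lies over `(q_v) ⊆ ℤ`. [folklore] -/
theorem liesOver_span_residueCard (v : HeightOneSpectrum (𝓞 ℚ)) :
    v.asIdeal.LiesOver (Ideal.span {(v.residueCard : ℤ)}) :=
  ⟨(under_int_eq_span_of_natCast_mem v.isPrime.ne_top (residueCard_prime v)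
    (Ideal.absNorm_mem v.asIdeal)).symm⟩

/-- An ideal `P` of `𝓞 M` above `v` contains `q_v`. [folklore] -/
theorem natCast_residueCard_mem_of_under_eq {M : Type*} [Field M] [NumberField M]
    {v : HeightOneSpectrum (𝓞 ℚ)} {P : Ideal (𝓞 M)}
    (hPv : P.under (𝓞 ℚ) = v.asIdeal) : (v.residueCard : 𝓞 M) ∈ P := by
  have h : (v.residueCard : 𝓞 ℚ) ∈ v.asIdeal := Ideal.absNorm_mem v.asIdeal
  rw [← hPv] at h
  have h' := Ideal.mem_comap.mp h
  rwa [map_natCast] at h'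

/-- A place `w` above `v` lies over `(q_v) ⊆ ℤ`. [folklore] -/
theorem liesOver_span_residueCard_of_under_eq {M : Type*} [Field M] [NumberField M]
    {v : HeightOneSpectrum (𝓞 ℚ)} {w : HeightOneSpectrum (𝓞 M)}
    (hwv : w.asIdeal.under (𝓞 ℚ) = v.asIdeal) :
    w.asIdeal.LiesOver (Ideal.span {(v.residueCard : ℤ)}) :=
  ⟨(under_int_eq_span_of_natCast_mem w.isPrime.ne_top (residueCard_prime v)
    (natCast_residueCard_mem_of_under_eq hwv)).symm⟩

/-- **The prime of `𝓞 ℚ` above `q_v` is `v`**: a prime ideal `P` of `𝓞 M` contains `q_v` iff it lies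
over `v` (`ℤ → 𝓞 ℚ` is surjective, Mathlib `Rat.int_algebraMap_surjective`, so an ideal of `𝓞 ℚ` is
determined by its contraction to `ℤ`). [folklore] -/
theorem natCast_residueCard_mem_iff_under_eq {M : Type*} [Field M] [NumberField M]
    (v : HeightOneSpectrum (𝓞 ℚ)) {P : Ideal (𝓞 M)} (hP : P.IsPrime) :
    (v.residueCard : 𝓞 M) ∈ P ↔ P.under (𝓞 ℚ) = v.asIdeal := by
  constructor
  · intro hmem
    have hsurj := Rat.int_algebraMap_surjective (𝓞 ℚ)
    have hQ : (P.under (𝓞 ℚ)).under ℤ = Ideal.span {(v.residueCard : ℤ)} :=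
      under_int_eq_span_of_natCast_mem (Ideal.comap_ne_top _ hP.ne_top) (residueCard_prime v)
        (Ideal.mem_comap.mpr (by rw [map_natCast]; exact hmem))
    have hV : v.asIdeal.under ℤ = Ideal.span {(v.residueCard : ℤ)} :=
      under_int_eq_span_of_natCast_mem v.isPrime.ne_top (residueCard_prime v)
        (Ideal.absNorm_mem v.asIdeal)
    calc P.under (𝓞 ℚ)
        = ((P.under (𝓞 ℚ)).under ℤ).map (algebraMap ℤ (𝓞 ℚ)) :=
          (Ideal.map_comap_of_surjective _ hsurj _).symm
      _ = (v.asIdeal.under ℤ).map (algebraMap ℤ (𝓞 ℚ)) := by rw [hQ, hV]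
      _ = v.asIdeal := Ideal.map_comap_of_surjective _ hsurj _
  · intro hPv
    exact natCast_residueCard_mem_of_under_eq hPv

/-! ### Splitting of `q_v ≠ p` in `ℚ(ζ_p)`: residue degrees and the number of places -/

/-- **`f(w|v) = ord_p(q_v)`**: for `q_v ≠ p`, every place `w` of `L = ℚ(ζ_p)` above the place `v` of
`ℚ` has residue degree (over `𝓞 ℚ`) the order of `q_v` in `(ℤ/p)^×` — Mathlib's
`IsCyclotomicExtension.Rat.inertiaDeg_eq_of_not_dvd` (residue degree over `ℤ`) and the tower law
`f(w|ℤ) = f(v|ℤ) f(w|v)` with `f(v|ℤ) = 1` (`N(v) = q_v`).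
Ref: Neukirch, *Algebraic Number Theory*, Ch. I (10.4). [folklore] -/
theorem inertiaDeg_eq_orderOf (p : ℕ) [hp : Fact p.Prime] {v : HeightOneSpectrum (𝓞 ℚ)}
    (hpv : ¬ v.residueCard ∣ p) {w : HeightOneSpectrum (𝓞 (CyclotomicField p ℚ))}
    (hwv : w.asIdeal.under (𝓞 ℚ) = v.asIdeal) :
    w.asIdeal.inertiaDeg (𝓞 ℚ) = orderOf (v.residueCard : ZMod p) := by
  haveI : Fact v.residueCard.Prime := ⟨residueCard_prime v⟩
  haveI : NeZero p := ⟨hp.out.ne_zero⟩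
  -- Mathlib's instances are stated for `CyclotomicField.instAlgebra`; the canonical `ℚ`-algebra
  -- structure `DivisionRing.toRatAlgebra` agrees with it definitionally (not reducibly).
  haveI : IsCyclotomicExtension {p} ℚ (CyclotomicField p ℚ) :=
    CyclotomicField.isCyclotomicExtension p ℚ
  haveI := w.isPrime
  haveI := liesOver_span_residueCard_of_under_eq hwv
  haveI := liesOver_span_residueCard v
  haveI : w.asIdeal.LiesOver v.asIdeal := ⟨hwv.symm⟩
  have hℤ : w.asIdeal.inertiaDeg ℤ = orderOf (v.residueCard : ZMod p) :=
    IsCyclotomicExtension.Rat.inertiaDeg_eq_of_not_dvd v.residueCard (CyclotomicField p ℚ)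
      w.asIdeal hpv
  have htower := Ideal.inertiaDeg_tower (R := ℤ) v.asIdeal w.asIdeal
  have hv1 : v.asIdeal.inertiaDeg ℤ = 1 := by
    haveI : (Ideal.span {(v.residueCard : ℤ)}).IsMaximal :=
      ((Ideal.span_singleton_prime (by exact_mod_cast (residueCard_prime v).ne_zero)).mpr
        (Nat.prime_iff_prime_int.mp (residueCard_prime v))).isMaximal
        (by simp [(residueCard_prime v).ne_zero])
    haveI := v.isMaximal
    have h := Ideal.absNorm_eq_pow_inertiaDeg' v.asIdeal (residueCard_prime v)
    rw [Ideal.inertiaDeg'_eq_inertiaDeg] at h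
    have h' : v.residueCard ^ 1 = v.residueCard ^ v.asIdeal.inertiaDeg ℤ := by
      rw [pow_one]
      exact h
    exact (Nat.pow_right_injective (residueCard_prime v).two_le h').symm
  rw [hv1, one_mul] at htower
  rw [← htower, hℤ]

/-- **`#{w ∣ v} · ord_p(q_v) = p - 1`** (`q_v ≠ p`): the number of places of `ℚ(ζ_p)` above `v` times
the common residue degree is `[ℚ(ζ_p) : ℚ] = p - 1` — the fundamental identity `e f g = n` (Mathlib
`Ideal.ncard_primesOver_mul_ramificationIdxIn_mul_inertiaDegIn`) with `e = 1` and `f = ord_p(q_v)`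
(`IsCyclotomicExtension.Rat.ramificationIdx_eq_of_not_dvd`, `inertiaDeg_eq_of_not_dvd`); the places
above `v` are the primes above `(q_v) ⊆ ℤ` (`natCast_residueCard_mem_iff_under_eq`).
Ref: Neukirch, *Algebraic Number Theory*, Ch. I §8, (10.4). [folklore] -/
theorem card_placesOver_mul_orderOf (p : ℕ) [hp : Fact p.Prime] {v : HeightOneSpectrum (𝓞 ℚ)}
    (hpv : ¬ v.residueCard ∣ p) :
    Nat.card {w : HeightOneSpectrum (𝓞 (CyclotomicField p ℚ)) // w.under (𝓞 ℚ) = v} *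
      orderOf (v.residueCard : ZMod p) = p - 1 := by
  haveI : Fact v.residueCard.Prime := ⟨residueCard_prime v⟩
  haveI : NeZero p := ⟨hp.out.ne_zero⟩
  haveI : IsCyclotomicExtension {p} ℚ (CyclotomicField p ℚ) :=
    CyclotomicField.isCyclotomicExtension p ℚ
  haveI : IsGalois ℚ (CyclotomicField p ℚ) := IsCyclotomicExtension.isGalois {p} ℚ _
  have hℓ0 : Ideal.span {(v.residueCard : ℤ)} ≠ ⊥ := by
    simp [(residueCard_prime v).ne_zero]
  haveI : (Ideal.span {(v.residueCard : ℤ)}).IsPrime :=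
    (Ideal.span_singleton_prime (by exact_mod_cast (residueCard_prime v).ne_zero)).mpr
      (Nat.prime_iff_prime_int.mp (residueCard_prime v))
  -- the places above `v` are the primes above `(q_v)`
  set f : {w : HeightOneSpectrum (𝓞 (CyclotomicField p ℚ)) // w.under (𝓞 ℚ) = v} →
      (Ideal.span {(v.residueCard : ℤ)}).primesOver (𝓞 (CyclotomicField p ℚ)) := fun w =>
    ⟨w.1.asIdeal, w.1.isPrime,
      liesOver_span_residueCard_of_under_eq (congrArg HeightOneSpectrum.asIdeal w.2)⟩ with hf
  have hfb : Function.Bijective f := by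
    constructor
    · intro w w' h
      have h1 : w.1.asIdeal = w'.1.asIdeal := congrArg (fun P => (P.1 : Ideal _)) h
      exact Subtype.ext (HeightOneSpectrum.ext h1)
    · rintro ⟨P, hP1, hP2⟩
      have hmem : (v.residueCard : 𝓞 (CyclotomicField p ℚ)) ∈ P := by
        have h1 : ((v.residueCard : ℕ) : ℤ) ∈ P.under ℤ := by
          rw [← hP2.over]
          exact Ideal.mem_span_singleton_self _
        have h2 := Ideal.mem_comap.mp h1
        rwa [map_natCast] at h2
      have hne : P ≠ ⊥ := Ideal.ne_bot_of_liesOver_of_ne_bot hℓ0 P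
      refine ⟨⟨⟨P, hP1, hne⟩, HeightOneSpectrum.ext
        ((natCast_residueCard_mem_iff_under_eq v hP1).mp hmem)⟩, rfl⟩
  have hcard : Nat.card {w : HeightOneSpectrum (𝓞 (CyclotomicField p ℚ)) // w.under (𝓞 ℚ) = v} =
      ((Ideal.span {(v.residueCard : ℤ)}).primesOver (𝓞 (CyclotomicField p ℚ))).ncard := by
    rw [Nat.card_congr (Equiv.ofBijective f hfb), Nat.card_coe_set_eq]
  -- the fundamental identity
  obtain ⟨⟨P, hP1, hP2⟩⟩ :=
    (Ideal.span {(v.residueCard : ℤ)}).nonempty_primesOver (S := 𝓞 (CyclotomicField p ℚ))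
  have hmain := Ideal.ncard_primesOver_mul_ramificationIdxIn_mul_inertiaDegIn
    (Ideal.span {(v.residueCard : ℤ)}) (𝓞 (CyclotomicField p ℚ))
    (CyclotomicField p ℚ ≃ₐ[ℚ] CyclotomicField p ℚ)
  rw [IsGaloisGroup.card_eq_finrank (CyclotomicField p ℚ ≃ₐ[ℚ] CyclotomicField p ℚ) ℚ
      (CyclotomicField p ℚ),
    IsCyclotomicExtension.Rat.finrank p (CyclotomicField p ℚ),
    Ideal.inertiaDegIn_eq_inertiaDeg (Ideal.span {(v.residueCard : ℤ)}) P
      (CyclotomicField p ℚ ≃ₐ[ℚ] CyclotomicField p ℚ),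
    Ideal.ramificationIdxIn_eq_ramificationIdx (Ideal.span {(v.residueCard : ℤ)}) P
      (CyclotomicField p ℚ ≃ₐ[ℚ] CyclotomicField p ℚ),
    IsCyclotomicExtension.Rat.ramificationIdx_eq_of_not_dvd v.residueCard (CyclotomicField p ℚ) P hpv,
    IsCyclotomicExtension.Rat.inertiaDeg_eq_of_not_dvd v.residueCard (CyclotomicField p ℚ) P hpv,
    one_mul, Nat.totient_prime hp.out] at hmain
  rw [hcard]
  exact hmain

/-! ### `∏_{j < p-1} (X - l^j) = (X^f - 1)^{(p-1)/f}` in characteristic `p` -/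

/-- **`∏_{j<p-1} (X - l^j) = (X^f - 1)^g`** over any `ℤ/p`-algebra, for `p ∤ l`, `f = ord_p(l)` and
`f g = p - 1`: `l ∈ (ℤ/p)^×` is a primitive `f`-th root of unity, so `X^f - 1 = ∏_{i<f} (X - l^i)`
(Mathlib `X_pow_sub_C_eq_prod`), and `l^{f a + i} = l^i`. [folklore] -/
theorem prod_range_X_sub_C_pow_eq (p : ℕ) [hp : Fact p.Prime] {F : Type*} [CommRing F]
    [Algebra (ZMod p) F] {ℓ : ℕ} (hℓ : ¬ p ∣ ℓ) {g : ℕ} (hg : orderOf (ℓ : ZMod p) * g = p - 1) :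
    ∏ j ∈ Finset.range (p - 1), (X - C ((ℓ : F) ^ j)) = (X ^ orderOf (ℓ : ZMod p) - 1) ^ g := by
  have hu0 : (ℓ : ZMod p) ≠ 0 := by
    rw [Ne, ZMod.natCast_eq_zero_iff]
    exact hℓ
  have hfin : IsOfFinOrder (ℓ : ZMod p) :=
    isOfFinOrder_iff_pow_eq_one.mpr ⟨p - 1, by have := hp.out.one_lt; omega,
      ZMod.pow_card_sub_one_eq_one hu0⟩
  have hf0 : 0 < orderOf (ℓ : ZMod p) := hfin.orderOf_pos
  have hprim : IsPrimitiveRoot (ℓ : ZMod p) (orderOf (ℓ : ZMod p)) := IsPrimitiveRoot.orderOf _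
  -- in `(ℤ/p)[X]`: `X^f - 1 = ∏_{i<f} (X - l^i)`
  have hA : ∏ i ∈ Finset.range (orderOf (ℓ : ZMod p)), (X - C ((ℓ : ZMod p) ^ i)) =
      X ^ orderOf (ℓ : ZMod p) - 1 := by
    have h := X_pow_sub_C_eq_prod hprim hf0 (one_pow (M := ZMod p) (orderOf (ℓ : ZMod p)))
    rw [map_one] at h
    rw [h]
    exact Finset.prod_congr rfl fun i _ => by rw [mul_one]
  have hB : ∀ g : ℕ, ∏ j ∈ Finset.range (orderOf (ℓ : ZMod p) * g), (X - C ((ℓ : ZMod p) ^ j)) =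
      (X ^ orderOf (ℓ : ZMod p) - 1) ^ g := by
    intro g
    induction g with
    | zero => simp
    | succ g ih =>
      rw [Nat.mul_succ, Finset.prod_range_add, ih, pow_succ, ← hA]
      congr 1
      refine Finset.prod_congr rfl fun i _ => ?_
      rw [pow_add, pow_mul, hprim.pow_eq_one, one_pow, one_mul]
  -- map to `F[X]`
  have hmap := congrArg (Polynomial.map (algebraMap (ZMod p) F)) (hB g)
  rw [hg, Polynomial.map_prod, Polynomial.map_pow, Polynomial.map_sub, Polynomial.map_pow, map_X,
    Polynomial.map_one] at hmap
  simp only [Polynomial.map_sub, map_X, Polynomial.map_pow, Polynomial.map_natCast, map_pow,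
    map_natCast] at hmap ⊢
  exact hmap

/-! ### The trivial character: `det(X - Ind(𝟙)(Frob_l)) = ∏_{j<p-1} (X - l^j)` -/

/-- **[Ash2003] for `θ = 𝟙`, Galois side**: for an odd prime `p`, `N ≥ 1`, a `ℤ/p`-algebra `F` of
coefficients and a Galois avatar `ϑ` of the TRIVIAL ray class character of `L = ℚ(ζ_p)` modulo
`(pN)` (`Ash2003.IsGaloisAvatar … 1 ϑ`: `ϑ` unramified at `w ∤ pN` with `ϑ(Frob_w) = 1`), the induced
representation `Ind_{Γ_L}^{Γ_ℚ} ϑ` has arithmetic-Frobenius characteristic polynomial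
`∏_{j < p-1} (X - q_v^j)` at every place `v` of `ℚ` with `q_v ∤ p · (pN)` — the polynomial of
`𝟙 ⊕ ω ⊕ ⋯ ⊕ ω^{p-2}`, and the Hecke–Frobenius polynomial `∑_k (-1)^k l^{k(k-1)/2} [p-1 choose k]_l X^{p-1-k}`
of the eigenvalue system of the constant function (Gauss's `q`-binomial identity; not here).
Proof: `hasFrobCharpolyAt_induce_of_isGaloisAvatar` gives `∏_{w ∣ v} (X^{f(w|v)} - 1)`, and
`f(w|v) = f = ord_p(q_v)` (`inertiaDeg_eq_orderOf`), `#{w ∣ v} · f = p - 1`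
(`card_placesOver_mul_orderOf`), `(X^f - 1)^{(p-1)/f} = ∏_{j<p-1} (X - q_v^j)`
(`prod_range_X_sub_C_pow_eq`). [cite: Ash2003, Thm. 1.1 and Lemma 4.2] -/
theorem hasFrobCharpolyAt_induce_of_isGaloisAvatar_one (p : ℕ) [hp : Fact p.Prime] {N : ℕ}
    (hN : N ≠ 0) {F : Type*} [CommRing F] [Algebra (ZMod p) F] [TopologicalSpace F]
    (ϑ : FramedGaloisRep (CyclotomicField p ℚ) F 1)
    (hϑ : IsGaloisAvatar
      (modulus_ne_bot (CyclotomicField p ℚ) (mul_ne_zero (Nat.Prime.ne_zero hp.out) hN))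
      (1 : RayClassGroup (modulus (CyclotomicField p ℚ) (p * N)) →* Fˣ) ϑ)
    {v : HeightOneSpectrum (𝓞 ℚ)} (hv : ¬ v.residueCard ∣ p * (p * N)) :
    (FramedGaloisRep.induce ℚ (finrank_cyclotomicField p) ϑ).HasFrobCharpolyAt v
      (∏ j ∈ Finset.range (p - 1), (X - C ((v.residueCard : F) ^ j))) := by
  classical
  have h := hasFrobCharpolyAt_induce_of_isGaloisAvatar p hN
    (1 : RayClassGroup (modulus (CyclotomicField p ℚ) (p * N)) →* Fˣ) ϑ hϑ hv
  have hpv : ¬ v.residueCard ∣ p := fun h' => hv (h'.trans (Dvd.intro _ rfl))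
  have hpl : ¬ p ∣ v.residueCard := not_dvd_residueCard p hv
  haveI : Fintype {w : HeightOneSpectrum (𝓞 (CyclotomicField p ℚ)) // w.under (𝓞 ℚ) = v} :=
    @Fintype.ofFinite _ (finite_heightOneSpectrum_under_eq v)
  have hfg : orderOf (v.residueCard : ZMod p) *
      Nat.card {w : HeightOneSpectrum (𝓞 (CyclotomicField p ℚ)) // w.under (𝓞 ℚ) = v} = p - 1 := by
    rw [mul_comm]
    exact card_placesOver_mul_orderOf p hpv
  convert h using 2
  rw [finprod_eq_prod_of_fintype, prod_range_X_sub_C_pow_eq p hpl hfg, Nat.card_eq_fintype_card,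
    ← Finset.card_univ, ← Finset.prod_const]
  refine Finset.prod_congr rfl fun w _ => ?_
  rw [MonoidHom.one_apply, Units.val_one, map_one,
    inertiaDeg_eq_orderOf p hpv (congrArg HeightOneSpectrum.asIdeal w.2)]

end Ash2003

end Literature.NumberTheory.Automorphic
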